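import Mathlib.Analysis.Matrix.Spectrum
import Mathlib.Order.Interval.Finset.Fin
import HarnessLib

/-!
# From an order-preserving residual pairing and ONE eigenvalue count to INDEXED enclosures

The bookkeeping step of large sparse symmetric eigenvalue certification («Lanczos proposes, an
inertia count certifies that nothing was missed»).  Two certificates are available for a real symmetric
/ Hermitian `A` with eigenvalues `λ↓₀ ≥ ⋯ ≥ λ↓_{n-1}` (Mathlib's antitone `eigenvalues₀`):

* a RESIDUAL PAIRING (Kahan 1967 / Stewart–Sun Cor IV.4.15; tree
  `Literature.Analysis.InnerProduct.exists_strictMono_abs_eigenvalues₀_sub_le_of_gram_bounds`): a strictly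
  increasing `f : Fin k → Fin n` with `|λ↓_{f j} − θ_j| ≤ ρ` for the `k` Ritz values `θ_j` of a frame;
* an EIGENVALUE COUNT at a cut `t` above every `θ_j + ρ` (spectrum slicing, Golub–Van Loan §8.4.2; tree
  `Literature.Analysis.Matrix.EigenvalueCountCertificates.card_pos_le_card_eigenvalues_gt_sub_of_residual`):
  at most `k` eigenvalues lie below `t`.

Then the `k` paired eigenvalues are exactly the `k` SMALLEST ones, in order: `f j = n − k + j` — the
pairing is the identity on the bottom block, every `θ_j ± ρ` encloses `λ↓_{n−k+j}`, and `t` is a lower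
bound for all the other eigenvalues (the «missing-eigenvalue exclusion»).  The content is purely
order-theoretic (`pairing_indexed_of_count`); the matrix statement
`eigenvalues₀_pairing_indexed_of_count` is its instance.  Everything is proved; no floating point appears (the two certificates are hypotheses in exactly
the form the tree theorems above conclude).

## References
* [GolubVanLoan2013] G. H. Golub, C. F. Van Loan, *Matrix Computations*, 4th ed. (2013), §8.4.2
  (eigenvalue counts by `LDLᵀ` / Sylvester) — the count.
* [StewartSun1990] G. W. Stewart, J.-G. Sun, *Matrix Perturbation Theory* (1990), Cor IV.4.15 /
  Exercise IV.4.7 (Kahan) — the pairing.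
-/

namespace Literature.Analysis.Matrix

open Finset

section Order

variable {n k : ℕ}

/-- A strictly increasing map `f : Fin k → Fin n` gains at least the index difference:
`f j + d ≤ f (j + d)` (private helper). [folklore] -/
private theorem val_add_le_of_strictMono {f : Fin k → Fin n} (hf : StrictMono f) (j : Fin k) (d : ℕ)
    (h : (j : ℕ) + d < k) : (f j : ℕ) + d ≤ (f ⟨j + d, h⟩ : ℕ) := by
  induction d with
  | zero => simp
  | succ d ih =>
    have h' : (j : ℕ) + d < k := by omega
    have hlt : f ⟨(j : ℕ) + d, h'⟩ < f ⟨(j : ℕ) + (d + 1), h⟩ :=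
      hf (Fin.mk_lt_mk.2 (by omega))
    have hlt' : (f ⟨(j : ℕ) + d, h'⟩ : ℕ) < (f ⟨(j : ℕ) + (d + 1), h⟩ : ℕ) := Fin.lt_def.1 hlt
    have := ih h'
    omega

/-- A strictly increasing `f : Fin k → Fin n` all of whose values are `≥ n − k` is forced:
`f j = n − k + j` (private helper). [folklore] -/
private theorem val_eq_of_strictMono_of_le {f : Fin k → Fin n} (hf : StrictMono f)
    (hlow : ∀ j, n - k ≤ (f j : ℕ)) (j : Fin k) : (f j : ℕ) = n - k + j := by
  have hjk : (j : ℕ) < k := j.isLt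
  have h0 : (0 : ℕ) + (j : ℕ) < k := by omega
  have hlo := val_add_le_of_strictMono hf ⟨0, by omega⟩ (j : ℕ) h0
  have hcast : (⟨(0 : ℕ) + (j : ℕ), h0⟩ : Fin k) = j := Fin.ext (by simp)
  rw [hcast] at hlo
  have hlow0 := hlow ⟨0, by omega⟩
  have hkj : (j : ℕ) + (k - 1 - j) < k := by omega
  have hhi := val_add_le_of_strictMono hf j (k - 1 - (j : ℕ)) hkj
  have hlast : (f ⟨(j : ℕ) + (k - 1 - (j : ℕ)), hkj⟩ : ℕ) < n := Fin.isLt _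
  omega

/-- **Pairing + count ⇒ the paired indices are the last `k`.** Let `ev : Fin n → ℝ` be antitone
(a descending enumeration), `f : Fin k → Fin n` strictly increasing with `ev (f j) < t` for all `j`, and
assume at most `k` values of `ev` lie strictly below `t`. Then `f j = n − k + j` for every `j`, and
`t ≤ ev i` for every index `i < n − k` (private helper; the public, cited form is
`pairing_indexed_of_count`). [folklore] -/
private theorem strictMono_pairing_eq_last {ev : Fin n → ℝ} (hev : Antitone ev) {f : Fin k → Fin n}
    (hf : StrictMono f) {t : ℝ} (hlt : ∀ j, ev (f j) < t)
    (hcount : #{i : Fin n | ev i < t} ≤ k) :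
    (∀ j, (f j : ℕ) = n - k + j) ∧ ∀ i : Fin n, (i : ℕ) < n - k → t ≤ ev i := by
  classical
  set S : Finset (Fin n) := univ.filter fun i : Fin n => ev i < t with hS
  have himg : univ.image f ⊆ S := by
    intro i hi
    obtain ⟨j, -, rfl⟩ := mem_image.1 hi
    exact mem_filter.2 ⟨mem_univ _, hlt j⟩
  have hcardimg : (univ.image f).card = k := by
    rw [card_image_of_injective _ hf.injective, card_univ, Fintype.card_fin]
  have hcardS : S.card = k :=
    le_antisymm hcount (hcardimg ▸ card_le_card himg)
  have hup : ∀ i : Fin n, ev i < t → n - k ≤ (i : ℕ) := by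
    intro i hi
    by_contra hcon
    push Not at hcon
    have hsub : Ici i ⊆ S := fun i' hi' =>
      mem_filter.2 ⟨mem_univ _, lt_of_le_of_lt (hev (mem_Ici.1 hi')) hi⟩
    have hle := card_le_card hsub
    rw [Fin.card_Ici, hcardS] at hle
    omega
  refine ⟨fun j => val_eq_of_strictMono_of_le hf (fun j => hup (f j) (hlt j)) j, fun i hi => ?_⟩
  by_contra hcon
  push Not at hcon
  have := hup i hcon
  omega

/-- **Indexed two-sided enclosures from a residual pairing and one count** (order-theoretic form). With
`ev` antitone, a strictly increasing pairing `f` with `|ev (f j) − θ_j| ≤ ρ`, every `θ_j + ρ < t`, and at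
most `k` values of `ev` below `t`: the `j`-th paired value IS the `(n − k + j)`-th entry,
`|ev (f j) − θ_j| ≤ ρ` reads as an enclosure of that entry, and `t ≤ ev i` for `i < n − k`.
[cite: GolubVanLoan2013, §8.4.2 (eigenvalue count) composed with Stewart–Sun Cor IV.4.15 (pairing)] -/
theorem pairing_indexed_of_count {ev : Fin n → ℝ} (hev : Antitone ev) {θ : Fin k → ℝ} {ρ t : ℝ}
    {f : Fin k → Fin n} (hf : StrictMono f) (hpair : ∀ j, |ev (f j) - θ j| ≤ ρ)
    (hsep : ∀ j, θ j + ρ < t) (hcount : #{i : Fin n | ev i < t} ≤ k) :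
    (∀ j, (f j : ℕ) = n - k + j ∧ θ j - ρ ≤ ev (f j) ∧ ev (f j) ≤ θ j + ρ) ∧
      ∀ i : Fin n, (i : ℕ) < n - k → t ≤ ev i := by
  have hlt : ∀ j, ev (f j) < t := fun j => by
    have h := (abs_sub_le_iff.1 (hpair j)).1
    linarith [hsep j]
  obtain ⟨hidx, hrest⟩ := strictMono_pairing_eq_last hev hf hlt hcount
  refine ⟨fun j => ⟨hidx j, ?_, ?_⟩, hrest⟩
  · have h := (abs_sub_le_iff.1 (hpair j)).2
    linarith
  · have h := (abs_sub_le_iff.1 (hpair j)).1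
    linarith

end Order

section Hermitian

variable {𝕜 : Type*} [RCLike 𝕜] {ι : Type*} [Fintype ι] [DecidableEq ι]

/-- **Indexed enclosures of the `k` smallest eigenvalues from a pairing and a count.** Let `A` be
Hermitian with descending eigenvalues `λ↓ = hA.eigenvalues₀`, let `f : Fin k → Fin (card ι)` be a strictly
increasing residual pairing with `|λ↓_{f j} − θ_j| ≤ ρ` (as produced by Kahan's theorem for a Ritz frame),
let the cut `t` satisfy `θ_j + ρ < t` for all `j`, and let at most `k` eigenvalues lie below `t` (an
inertia / spectrum-slicing count). Then `f j = card ι − k + j`: each `[θ_j − ρ, θ_j + ρ]` encloses the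
`j`-th SMALLEST eigenvalue `λ↓_{card ι − k + j}`, and `t ≤ λ↓_i` for every `i < card ι − k` — no eigenvalue
below the cut was missed.
[cite: GolubVanLoan2013, §8.4.2 (eigenvalue count) composed with Stewart–Sun Cor IV.4.15 (pairing)] -/
theorem eigenvalues₀_pairing_indexed_of_count {A : _root_.Matrix ι ι 𝕜} (hA : A.IsHermitian) {k : ℕ}
    {θ : Fin k → ℝ} {ρ t : ℝ} {f : Fin k → Fin (Fintype.card ι)} (hf : StrictMono f)
    (hpair : ∀ j, |hA.eigenvalues₀ (f j) - θ j| ≤ ρ) (hsep : ∀ j, θ j + ρ < t)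
    (hcount : #{i : Fin (Fintype.card ι) | hA.eigenvalues₀ i < t} ≤ k) :
    (∀ j, (f j : ℕ) = Fintype.card ι - k + j ∧
        θ j - ρ ≤ hA.eigenvalues₀ (f j) ∧ hA.eigenvalues₀ (f j) ≤ θ j + ρ) ∧
      ∀ i : Fin (Fintype.card ι), (i : ℕ) < Fintype.card ι - k → t ≤ hA.eigenvalues₀ i :=
  pairing_indexed_of_count hA.eigenvalues₀_antitone hf hpair hsep hcount

end Hermitian

end Literature.Analysis.Matrix
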